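import Summits.CriticalPhenomena.PercolationContinuityZ3.Theorems.PercNearOneGluingNoHeavyQuantCombSpliceProb
import Summits.CriticalPhenomena.PercolationContinuityZ3.Theorems.PercNearOneGluingNoHeavyQuantCombGlueBelow
import Summits.CriticalPhenomena.PercolationContinuityZ3.Theorems.PercNearOneGluingNoHeavyQuantCombNoInteriorMin
import Summits.CriticalPhenomena.PercolationContinuityZ3.Theorems.PercNearOneGluingNoHeavyQuantFarTreeCombBase
import HarnessLib

/-!
# QUANT lane R8 — **FAR at every layer on combs, by the relocation lemma** (`Quant.farTree_comb`): a second, independent kernel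
# proof of the far-relay row `Quant.FarTreeRow` on the comb family

builds on p205010 (kernel theorem, internal audit signed; external expert review pending)

Support file (`--supports stmt-CriticalPhenomena-4575`), QUANT lane lead (gen 9), rung R8 of `run/shared/lean/prim/quant/LADDER.md`;
memo `prim-quant-lead-g9/LEAD-NOTES-G9.md` N20 — the assembly of the lead's kernel proof of LEAD-NOTES-G8 N19 (2) ("all-layers singles chain
lemma ⟹ FAR at every layer on combs").  The FIRST kernel proof of this family is prim-quant-p1 g6's `Quant.farTreeRow_comb`
(`…QuantFarTreeComb.lean`, p233714, via the SOJOURN LEMMA `Quant.CountDP.sojourn_ge_one`); the present file proves it by a different route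
(the two-endpoint RELOCATION lemma below), with slightly different bookkeeping hypotheses (relay-restricted, unglued spine), so the two
developments cross-check each other.  Coordinates of `Quant.FarTreeRow` (`…QuantFarTreeRow.lean`): gates `prodBernoulli q` on `Set ι`, a relay `z`
is reached iff its ancestor finset `P z` is open, marginal `T z = ∏_{P z} q`.  A COMB around the distinguished relay `a`: the spine `P a` is an
unglued chain with down-closed prefixes; every relay owns its tip (`z ∈ P z`), has a down-closed spine part, and the private parts `P z ∖ P a`
of distinct relays are disjoint (every relay off the spine hangs off it by its own hair); `a` is the least likely relay.  This contains stars,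
caterpillars whose least likely relay is the tip of the spine, and 'hub + leaf relays + root singles' with a hub-leaf argmin — relays at
arbitrarily many nested levels, arbitrary layer `j`.

* `Quant.farTree_comb_aux` — induction on the number of hairs attached at a positive level.  STEP (the two-endpoint relocation lemma, N20 (4)):
  for such a hair `b` (marginal `T`, level `ℓ`), with `L₀, e_k, a_k, π_k` the light probability, tails, level laws and prefix products of the
  configuration without `b` (`…QuantCombTails.lean`):  current cost `L₀ − T·e_ℓ/π_ℓ` (hair conditioning), TOP endpoint `L₀ − T·e_0`
  (`…QuantCombMoveTop.lean`), SPLICE endpoint `L₀ − e_{m+1} − (T − π_{m+1})·a_m` at the deepest level `m` with `π_m ≥ T`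
  (`…QuantCombSpliceProb.lean`; `…QuantCombGlueBelow.lean` when `T = T a`); the no-interior-minimum lemma (`Quant.comb_noInteriorMin`, fed by the
  tail recursion and the no-rise-after-a-fall property of `a_k`) says the current cost is at most the larger endpoint cost, and both endpoints are
  combs with one hair fewer and the same marginals.  BASE: `Quant.farTree_comb_base` (a spider; `Quant.far_indepLegs_sub`).
* `Quant.farTree_comb` — **FAR on combs, every layer**: `2j < Σ_{z∈A} T z` and `1 − T z ≤ t` on `A` imply `P(#{z ∈ A | P z open} ≤ j) ≤ t`.
[this work] [cite: KozmaNitzan2024, Conjecture 3 (p. 15)] (the gluing rows this tree row serves)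
-/

noncomputable section

namespace Summit.CriticalPhenomena.PercolationContinuityZ3.Theorems

namespace Quant

open Finset MeasureTheory
open Literature.Probability.LatticeModels
open Literature.Probability.Percolation
open scoped Classical

variable {ι : Type*} [Fintype ι]

/-- **FAR on combs — the induction** on the number of hairs attached at a positive level (see the module docstring). [this work] -/
theorem farTree_comb_aux (n : ℕ) :
    ∀ (q : ι → unitInterval) (P : ι → Finset ι) (A : Finset ι) (a : ι) (j : ℕ),
      (∀ y ∈ P a, y ∈ P y ∧ P y ⊆ P a ∧ ∀ y' ∈ P a,
        (y ∈ P y' ∨ y' ∈ P y) ∧ (y ∈ P y' → P y ⊆ P y') ∧ (y ∈ P y' → y' ∈ P y → y = y')) →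
      a ∈ P a →
      (∀ z ∈ A, ∀ y ∈ P z, y ∈ P a → P y ⊆ P z) →
      (∀ z ∈ A, ∀ z' ∈ A, z ≠ z' → Disjoint (P z \ P a) (P z' \ P a)) →
      (∀ z ∈ A, z ∈ P z) →
      (∀ z ∈ A, ∏ y ∈ P a, (q y : ℝ) ≤ ∏ y ∈ P z, (q y : ℝ)) →
      0 < ∏ y ∈ P a, (q y : ℝ) →
      (2 * j : ℝ) < ∑ z ∈ A, ∏ y ∈ P z, (q y : ℝ) →
      (A.filter fun z => ¬ P z ⊆ P a ∧ (P z ∩ P a).Nonempty).card = n →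
      (prodBernoulli q).real {ω : Set ι | (A.filter fun z => ((P z : Finset ι) : Set ι) ⊆ ω).card ≤ j} ≤
        1 - ∏ y ∈ P a, (q y : ℝ) := by
  induction n with
  | zero =>
    intro q P A a j hsp _ _ hA6 hA8 hA9 _ hmean hn
    refine farTree_comb_base q P A a j hsp hA6 hA8 hA9 hmean fun z hz => ?_
    have h0 : ¬ (¬ P z ⊆ P a ∧ (P z ∩ P a).Nonempty) := (Finset.filter_eq_empty_iff.1 (Finset.card_eq_zero.1 hn)) hz
    by_cases h1 : P z ⊆ P a
    · exact Or.inl h1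
    · exact Or.inr (Finset.not_nonempty_iff_eq_empty.1 fun h2 => h0 ⟨h1, h2⟩)
  | succ n ih =>
    intro q P A a j hsp haa hA5 hA6 hA8 hA9 hpos hmean hn
    have hq0 : ∀ y, 0 ≤ (q y : ℝ) := fun y => (q y).2.1
    have hq1 : ∀ y, (q y : ℝ) ≤ 1 := fun y => (q y).2.2
    -- a hair at a positive level
    obtain ⟨b, hbH⟩ : (A.filter fun z => ¬ P z ⊆ P a ∧ (P z ∩ P a).Nonempty).Nonempty := by
      rw [← Finset.card_pos, hn]; exact Nat.succ_pos n
    obtain ⟨hbA, hbns, -⟩ := Finset.mem_filter.1 hbH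
    have hbb : b ∈ P b := hA8 b hbA
    have hba : b ∉ P a := fun h => hbns (hsp b h).2.1
    -- notation
    set μ := prodBernoulli q with hμ
    set x : ℝ := ∏ y ∈ P a, (q y : ℝ) with hx
    set d : ℕ := (P a).card with hd
    set S : ℕ → Finset ι := fun k => (P a).filter fun y => (P y).card ≤ k with hS
    set ℓ : ℕ := (P b ∩ P a).card with hℓ
    set T : ℝ := ∏ y ∈ P b, (q y : ℝ) with hT
    set A' : Finset ι := A.erase b with hA'
    set L0 : ℝ := μ.real {ω : Set ι | (A'.filter fun z => ((P z : Finset ι) : Set ι) ⊆ ω).card ≤ j} with hL0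
    set e : ℕ → ℝ := fun k => μ.real {ω : Set ι | (A'.filter fun z => ((P z : Finset ι) : Set ι) ⊆ ω).card = j ∧
      ((S k : Finset ι) : Set ι) ⊆ ω} with he
    set av : ℕ → ℝ := fun k => μ.real {ω : Set ι |
      ((A'.filter fun z => (P z ∩ P a).card ≤ k).filter fun z => (((P z \ P a) : Finset ι) : Set ι) ⊆ ω).card = j} with hav
    set πS : ℕ → ℝ := fun k => ∏ y ∈ S k, (q y : ℝ) with hπS
    -- prefix products
    have hSsub : ∀ k, S k ⊆ P a := fun k => Finset.filter_subset _ _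
    have hπx : ∀ k, x ≤ πS k := fun k =>
      Finset.prod_le_prod_of_subset_of_le_one (hSsub k) (fun y _ => hq0 y) fun y _ _ => hq1 y
    have hπpos : ∀ k, 0 < πS k := fun k => lt_of_lt_of_le hpos (hπx k)
    have hπmono : ∀ {k k'}, k ≤ k' → πS k' ≤ πS k := fun h =>
      Finset.prod_le_prod_of_subset_of_le_one (comb_level_mono P a h) (fun y _ => hq0 y) fun y _ _ => hq1 y
    have hπ0 : πS 0 = 1 := by simp only [hπS, hS, comb_level_zero P a hsp, Finset.prod_empty]
    have hℓd : ℓ ≤ d := comb_relay_level_le P a b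
    -- the hair `b`: spine level, private part, marginal
    have hPb : P b = S ℓ ∪ (P b \ P a) := comb_relay_prefix_eq P a hsp (hA5 b hbA)
    have hdisjb : Disjoint (S ℓ) (P b \ P a) := (Finset.disjoint_sdiff.mono_left (hSsub ℓ)).symm.symm
    have hTsplit : T = πS ℓ * ∏ y ∈ P b \ P a, (q y : ℝ) := by
      rw [hT]; conv_lhs => rw [hPb, Finset.prod_union hdisjb]
    have hple1 : ∏ y ∈ P b \ P a, (q y : ℝ) ≤ 1 := Finset.prod_le_one (fun y _ => hq0 y) fun y _ => hq1 y
    have hTx : x ≤ T := hA9 b hbA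
    have hTpos : 0 < T := lt_of_lt_of_le hpos hTx
    have hTπ : T ≤ πS ℓ := by rw [hTsplit]; exact mul_le_of_le_one_right (hπpos ℓ).le hple1
    have hT1 : T ≤ 1 := Finset.prod_le_one (fun y _ => hq0 y) fun y _ => hq1 y
    -- the configuration without `b`
    have hA5' : ∀ z ∈ A', ∀ y ∈ P z, y ∈ P a → P y ⊆ P z := fun z hz => hA5 z (Finset.mem_of_mem_erase hz)
    have hA6' : ∀ z ∈ A', ∀ z' ∈ A', z ≠ z' → Disjoint (P z \ P a) (P z' \ P a) := fun z hz z' hz' =>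
      hA6 z (Finset.mem_of_mem_erase hz) z' (Finset.mem_of_mem_erase hz')
    -- current cost (hair conditioning)
    have hcur : μ.real {ω : Set ι | (A.filter fun z => ((P z : Finset ι) : Set ι) ⊆ ω).card ≤ j} =
        L0 - (∏ y ∈ P b \ P a, (q y : ℝ)) * e ℓ := by
      have h := comb_hair_conditioning q P a A' j (Finset.notMem_erase b A) hsp hA5' (hA5 b hbA)
        (fun z hz => hA6 z (Finset.mem_of_mem_erase hz) b hbA (Finset.ne_of_mem_erase hz))
      rw [hA', Finset.insert_erase hbA] at h
      exact h
    -- the sequences for the no-interior-minimum lemma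
    set πf : ℕ → ℝ := fun k => if k ≤ d then πS k else 0 with hπf
    set ef : ℕ → ℝ := fun k => if k ≤ d then e k else 0 with hef
    have hposf : ∀ k ≤ d, 0 < πf k := fun k hk => by simp only [hπf, if_pos hk]; exact hπpos k
    have hantif : ∀ k ≤ d, πf (k + 1) ≤ πf k := by
      intro k hk
      simp only [hπf, if_pos hk]
      by_cases hk1 : k + 1 ≤ d
      · rw [if_pos hk1]; exact hπmono (Nat.le_succ k)
      · rw [if_neg hk1]; exact (hπpos k).le
    have hπfd : πf (d + 1) = 0 := by simp [hπf]
    have hefd : ef (d + 1) = 0 := by simp [hef]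
    have hrec : ∀ k ≤ d, ef k = (πf k - πf (k + 1)) * av k + ef (k + 1) := by
      intro k hk
      rcases Nat.lt_or_ge k d with hlt | hge
      · simp only [hef, hπf, if_pos hk, if_pos (Nat.succ_le_of_lt hlt)]
        exact comb_tail_step q P a A' j hsp hA5' k
      · have hkd : k = d := le_antisymm hk hge
        rw [hkd]
        have h1 : ¬ d + 1 ≤ d := Nat.not_succ_le_self d
        simp only [hef, hπf, le_refl, if_true, if_neg h1, sub_zero, add_zero]
        exact comb_tail_top q P a A' j hsp hA5'
    have hU : ∀ i k l, i < k → k ≤ l → l ≤ d → av k < av i → av l ≤ av k :=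
      fun i k l hik hkl _ hfall => comb_levelLaw_noRise q P a A' j hA6' hik hkl hfall
    -- the deepest level of weight at least `T`
    have hπf0 : πf 0 = 1 := by simp only [hπf, if_pos (Nat.zero_le d)]; exact hπ0
    obtain ⟨m, hmd, hTm, hm⟩ := comb_exists_deepest_level πf T d (by rw [hπf0]; exact hT1)
    have hTm' : T ≤ πS m := by simpa only [hπf, if_pos hmd] using hTm
    have hT2 : πf (m + 1) ≤ T := by
      rcases hm with rfl | h
      · rw [hπfd]; exact hTpos.le
      · exact h.le
    have hℓm : ℓ ≤ m := by
      by_contra hlt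
      have hm1 : m + 1 ≤ ℓ := by omega
      rcases hm with rfl | h
      · omega
      · have : πf (m + 1) = πS (m + 1) := by simp only [hπf, if_pos (hm1.trans hℓd)]
        rw [this] at h
        exact absurd (hTπ.trans (hπmono hm1)) (not_le.2 h)
    -- the no-interior-minimum inequality
    have hNIM := comb_noInteriorMin d πf av ef hposf hantif hπfd hrec hefd hU hmd hℓm hTpos hTm hT2
    have hcurv : T * ef ℓ / πf ℓ = (∏ y ∈ P b \ P a, (q y : ℝ)) * e ℓ := by
      simp only [hef, hπf, if_pos hℓd]
      rw [hTsplit, mul_assoc, mul_div_cancel_left₀ _ (hπpos ℓ).ne']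
    have htopv : T * ef 0 / πf 0 = T * e 0 := by
      rw [hπf0, div_one]; simp only [hef, if_pos (Nat.zero_le d)]
    rw [hcurv, htopv] at hNIM
    -- ### the TOP endpoint
    set vtop : unitInterval := ⟨(q b : ℝ) * πS ℓ, mul_nonneg (hq0 b) (hπpos ℓ).le,
      mul_le_one₀ (hq1 b) (hπpos ℓ).le (Finset.prod_le_one (fun y _ => hq0 y) fun y _ => hq1 y)⟩ with hvtop
    set Pt : ι → Finset ι := Function.update P b (P b \ P a) with hPt
    set qt : ι → unitInterval := Function.update q b vtop with hqt
    have hPtb : Pt b = P b \ P a := by simp [hPt]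
    have hPt' : ∀ y, y ≠ b → Pt y = P y := fun y hy => by simp [hPt, hy]
    have hqt' : ∀ i, i ≠ b → qt i = q i := fun i hi => by simp [hqt, hi]
    have hqtT : ∏ y ∈ P b \ P a, (qt y : ℝ) = ∏ y ∈ P b, (q y : ℝ) := by
      have hbQ : b ∈ P b \ P a := Finset.mem_sdiff.2 ⟨hbb, hba⟩
      have hqtb : (qt b : ℝ) = (q b : ℝ) * πS ℓ := by simp [hqt, hvtop]
      rw [← Finset.mul_prod_erase _ _ hbQ, hqtb, Finset.prod_congr rfl fun y hy => by rw [hqt' y (Finset.ne_of_mem_erase hy)],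
        ← hT, hTsplit, ← Finset.mul_prod_erase (P b \ P a) (fun y => (q y : ℝ)) hbQ]
      ring
    have htop_le : (prodBernoulli qt).real {ω : Set ι | (A.filter fun z => ((Pt z : Finset ι) : Set ι) ⊆ ω).card ≤ j} ≤ 1 - x := by
      obtain ⟨hPta, -, hspt⟩ := comb_top_spine P Pt a hba hbb hPt' hsp
      obtain ⟨-, hA5t, hA6t, hA8t⟩ := comb_top_relays P Pt a A hbA hba hbb hPtb hPt' hA5 hA6 hA8
      obtain ⟨hxt, hTt⟩ := comb_top_marginal q qt P Pt a A hbA hba hbb hPtb hPt' hqt' hqtT hA6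
      have h := ih qt Pt A a j hspt (by rw [hPta]; exact haa) hA5t hA6t hA8t
        (fun z hz => by rw [hxt, hTt z hz]; exact hA9 z hz) (by rw [hxt]; exact hpos)
        (by rw [Finset.sum_congr rfl fun z hz => hTt z hz]; exact hmean)
        (by rw [comb_top_measure P Pt a A hbA hba hbb hPtb hPt', Finset.card_erase_of_mem hbH, hn]; rfl)
      rwa [hxt] at h
    have htop_eq : (prodBernoulli qt).real {ω : Set ι | (A.filter fun z => ((Pt z : Finset ι) : Set ι) ⊆ ω).card ≤ j} =
        L0 - T * e 0 :=
      comb_top_light_eq q qt P Pt a A j hsp hA5 hA6 hbA hba hbb hPtb hPt' hqt' hqtT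
    -- ### the SPLICE endpoint
    have hspl : L0 - ((T - πf (m + 1)) * av m + ef (m + 1)) ≤ 1 - x := by
      rcases Nat.lt_or_ge m d with hmlt | hmge
      · -- splice between level `m` and the gate of rank `m+1`
        have hπlt : πS (m + 1) < T := by
          rcases hm with h | h
          · omega
          · simpa only [hπf, if_pos (Nat.succ_le_of_lt hmlt)] using h
        obtain ⟨s, hs1, hs0⟩ : ∃ s ∈ S (m + 1), s ∉ S m := by
          by_contra h
          push Not at h
          have hsub : S (m + 1) = S m := Finset.Subset.antisymm h (comb_level_mono P a (Nat.le_succ m))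
          have : πS (m + 1) = πS m := by simp only [hπS]; rw [hsub]
          exact absurd (hTm'.trans_eq this.symm) (not_le.2 hπlt)
        have hs : s ∈ P a := (Finset.mem_filter.1 hs1).1
        have hsm : (P s).card = m + 1 := by
          have h1 := (Finset.mem_filter.1 hs1).2
          have h2 : ¬ (P s).card ≤ m := fun h => hs0 (Finset.mem_filter.2 ⟨hs, h⟩)
          omega
        have hSm1 : S (m + 1) = S m ∪ {s} := comb_level_succ_eq P a hsp hs1 hs0
        have hπsucc : πS (m + 1) = πS m * q s := by
          simp only [hπS]; rw [hSm1, Finset.prod_union (Finset.disjoint_singleton_right.2 hs0), Finset.prod_singleton]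
        have hsb : s ≠ b := fun h => hba (h ▸ hs)
        set vb : unitInterval := ⟨T / πS m, div_nonneg hTpos.le (hπpos m).le, (div_le_one (hπpos m)).2 hTm'⟩ with hvb
        set vs : unitInterval := ⟨πS (m + 1) / T, div_nonneg (hπpos (m + 1)).le hTpos.le, (div_le_one hTpos).2 hπlt.le⟩
          with hvs
        set Ps : ι → Finset ι := fun y => if y = b then insert b (S m) else if s ∈ P y then insert b (P y) else P y with hPs
        set qs : ι → unitInterval := Function.update (Function.update q s vs) b vb with hqs
        have hPsb : Ps b = insert b ((P a).filter fun y => (P y).card ≤ m) := by simp [hPs, hS]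
        have hPs1 : ∀ y, y ≠ b → s ∈ P y → Ps y = insert b (P y) := fun y hy hsy => by simp [hPs, hy, hsy]
        have hPs2 : ∀ y, y ≠ b → s ∉ P y → Ps y = P y := fun y hy hsy => by simp [hPs, hy, hsy]
        have hqs' : ∀ i, i ≠ b → i ≠ s → qs i = q i := fun i hib his => by simp [hqs, hib, his]
        have hqsb : (qs b : ℝ) = T / πS m := by simp [hqs, hvb]
        have hqss : (qs s : ℝ) = πS (m + 1) / T := by simp [hqs, Function.update_of_ne hsb, hvs]
        have hπm0 : πS m ≠ 0 := (hπpos m).ne'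
        have hT0 : T ≠ 0 := hTpos.ne'
        have hqsprod : (qs s : ℝ) * qs b = q s := by
          rw [hqsb, hqss, hπsucc]; field_simp
        have hv : (qs b : ℝ) * πS m = T := by rw [hqsb]; exact div_mul_cancel₀ T hπm0
        have hqsbT : (qs b : ℝ) * ∏ y ∈ (P a).filter (fun y => (P y).card ≤ m), (q y : ℝ) = ∏ y ∈ P b, (q y : ℝ) := hv
        have hsps := comb_splice_spine P Ps a hsp hba hbb hs hsm hPsb hPs1 hPs2
        obtain ⟨-, -, hA5s, hA6s, hA8s⟩ := comb_splice_relays P Ps a A hsp hA5 hA6 hA8 hbA hba hs hsm hPsb hPs1 hPs2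
        obtain ⟨hxs, hTs⟩ := comb_splice_marginal q qs P Ps a A hsp hA6 hbA hba hbb hs hsm hPsb hPs1 hPs2 hqs' hqsprod hqsbT
        have hPsa : Ps a = insert b (P a) := comb_splice_spine_eq P Ps a hba hbb hs hPs1
        have h := ih qs Ps A a j hsps (by rw [hPsa]; exact Finset.mem_insert_of_mem haa) hA5s hA6s hA8s
          (fun z hz => by rw [hxs, hTs z hz]; exact hA9 z hz) (by rw [hxs]; exact hpos)
          (by rw [Finset.sum_congr rfl fun z hz => hTs z hz]; exact hmean)
          (by rw [comb_splice_measure P Ps a A hA6 hbA hba hbb hs hPsb hPs1 hPs2, Finset.card_erase_of_mem hbH, hn]; rfl)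
        rw [hxs] at h
        have heq : (prodBernoulli qs).real {ω : Set ι | (A.filter fun z => ((Ps z : Finset ι) : Set ι) ⊆ ω).card ≤ j} =
            L0 - (e (m + 1) + ((qs b : ℝ) * πS m - πS (m + 1)) * av m) :=
          comb_splice_light_eq q qs P Ps a A j hsp hA5 hA6 hbA hba hbb hs hsm hPsb hPs1 hPs2 hqs' hqsprod
        have h1 : πf (m + 1) = πS (m + 1) := by simp only [hπf, if_pos (Nat.succ_le_of_lt hmlt)]
        have h2 : ef (m + 1) = e (m + 1) := by simp only [hef, if_pos (Nat.succ_le_of_lt hmlt)]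
        rw [h1, h2]; rw [heq, hv] at h; linarith
      · -- `T = T a`: glue `b` below `a`
        have hmd' : m = d := le_antisymm hmd hmge
        have hπSd : πS d = x := by simp only [hπS, hS, hd, comb_level_top P a hsp, hx]
        have hTeq : T = x := le_antisymm (hTm'.trans (by rw [hmd', hπSd])) hTx
        set Pg : ι → Finset ι := Function.update P b (insert b (P a)) with hPg
        set qg : ι → unitInterval := Function.update q b 1 with hqg
        have hPgb : Pg b = insert b (P a) := by simp [hPg]
        have hPg' : ∀ y, y ≠ b → Pg y = P y := fun y hy => by simp [hPg, hy]
        have hqg' : ∀ i, i ≠ b → qg i = q i := fun i hi => by simp [hqg, hi]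
        have hqgb : (qg b : ℝ) = 1 := by simp [hqg]
        have hspg := comb_glue_spine P Pg a hba hbb hPgb hPg' hsp
        obtain ⟨-, hA5g, hA6g, hA8g⟩ := comb_glue_relays P Pg a A hbA hba hbb hPgb hPg' hsp hA5 hA6 hA8
        obtain ⟨hxg, hTg⟩ := comb_glue_marginal q qg P Pg a A hbA hba hbb hPgb hPg' hqg' hqgb hA6
        have hTg' : ∀ z ∈ A, (∏ y ∈ Pg z, (qg y : ℝ)) = ∏ y ∈ P z, (q y : ℝ) := by
          intro z hz
          by_cases hzb : z = b
          · subst hzb; rw [hxg, ← hx, ← hTeq]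
          · exact hTg z hz hzb
        have h := ih qg Pg A b j hspg (by rw [hPgb]; exact Finset.mem_insert_self _ _) hA5g hA6g hA8g
          (fun z hz => by rw [hxg, hTg' z hz]; exact hA9 z hz) (by rw [hxg]; exact hpos)
          (by rw [Finset.sum_congr rfl fun z hz => hTg' z hz]; exact hmean)
          (by rw [comb_glue_measure P Pg a A hbA hba hbb hPgb hPg' hA6, Finset.card_erase_of_mem hbH, hn]; rfl)
        rw [hxg] at h
        have heq : (prodBernoulli qg).real {ω : Set ι | (A.filter fun z => ((Pg z : Finset ι) : Set ι) ⊆ ω).card ≤ j} =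
            L0 - e d := comb_glue_light_eq q qg P Pg a A j hsp hA5 hA6 hbA hba hbb hPgb hPg' hqg' hqgb
        have h4 : e d = πS d * av d := comb_tail_top q P a A' j hsp hA5'
        rw [hmd', hπfd, hefd, sub_zero, add_zero, hTeq, ← hπSd, ← h4, hπSd]
        rw [heq] at h; exact h
    -- ### conclusion
    rw [hcur]
    rcases le_total (T * e 0) ((T - πf (m + 1)) * av m + ef (m + 1)) with hle | hle
    · rw [min_eq_left hle] at hNIM; linarith [htop_le, htop_eq]
    · rw [min_eq_right hle] at hNIM; linarith [hspl]

/-- **FAR at every layer on combs.**  In the coordinates of `Quant.FarTreeRow`: let the spine `P a` of the distinguished relay `a` be an unglued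
chain with down-closed prefixes (`y ∈ P y ⊆ P a`, comparability, `y ∈ P y' → P y ⊆ P y'`, antisymmetry, for spine gates), let every relay own
its tip and have a down-closed spine part, let the private parts `P z ∖ P a` of distinct relays be disjoint, and let `a` be the least likely
relay.  Then `2j < Σ_{z∈A} ∏_{P z} q` and `1 − ∏_{P z} q ≤ t` (`z ∈ A`) imply `P(#{z ∈ A | P z open} ≤ j) ≤ t` — the body of
`Quant.FarTreeRow` on the comb family, for EVERY layer `j`. [this work] -/
theorem farTree_comb (q : ι → unitInterval) (P : ι → Finset ι) (A : Finset ι) (a : ι) (j : ℕ) (t : ℝ)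
    (hsp : ∀ y ∈ P a, y ∈ P y ∧ P y ⊆ P a ∧ ∀ y' ∈ P a,
      (y ∈ P y' ∨ y' ∈ P y) ∧ (y ∈ P y' → P y ⊆ P y') ∧ (y ∈ P y' → y' ∈ P y → y = y'))
    (ha : a ∈ A) (haa : a ∈ P a)
    (hA5 : ∀ z ∈ A, ∀ y ∈ P z, y ∈ P a → P y ⊆ P z)
    (hA6 : ∀ z ∈ A, ∀ z' ∈ A, z ≠ z' → Disjoint (P z \ P a) (P z' \ P a))
    (hA8 : ∀ z ∈ A, z ∈ P z)
    (hA9 : ∀ z ∈ A, ∏ y ∈ P a, (q y : ℝ) ≤ ∏ y ∈ P z, (q y : ℝ))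
    (hmean : (2 * j : ℝ) < ∑ z ∈ A, ∏ y ∈ P z, (q y : ℝ))
    (ht : ∀ z ∈ A, 1 - ∏ y ∈ P z, (q y : ℝ) ≤ t) :
    (prodBernoulli q).real {ω : Set ι | (A.filter fun z => ((P z : Finset ι) : Set ι) ⊆ ω).card ≤ j} ≤ t := by
  have hta : 1 - ∏ y ∈ P a, (q y : ℝ) ≤ t := ht a ha
  by_cases hpos : 0 < ∏ y ∈ P a, (q y : ℝ)
  · exact (farTree_comb_aux _ q P A a j hsp haa hA5 hA6 hA8 hA9 hpos hmean rfl).trans hta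
  · have hx0 : ∏ y ∈ P a, (q y : ℝ) = 0 := le_antisymm (not_lt.1 hpos) (Finset.prod_nonneg fun y _ => (q y).2.1)
    rw [hx0, sub_zero] at hta
    exact measureReal_le_one.trans hta

end Quant

end Summit.CriticalPhenomena.PercolationContinuityZ3.Theorems

end
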